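import Literature.MathematicalPhysics.QuantumFieldTheory.Balaban1983to89.B9

/-!
# `Balaban1983to89.B9SectCWalkTermsAllNorms` — [Balaban1985BackgroundPropagators] Sect. C, the ALL-NORMS clauses of
# Corollary 3.8 (p. 410: *«Similar estimates hold for the other norms»*) and of Theorem 3.10 (p. 416: *«and the
# corresponding inequalities for norms on the left-hand sides of (3.42)–(3.47)»*) as PER-WALK-TERM blocks over the
# carriers of `…Balaban1983to89.B9`

statement-level skeleton of published theorems with citation tags; proofs where landed; nothing here is a claim about the
Yang–Mills mass gap

T. Bałaban, *Propagators for lattice gauge theories in a background field*, Commun. Math. Phys. **99**, 389–434 (1985)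
[Balaban1985BackgroundPropagators] (cell paper B9; PDF held `paper:balaban1985-cmp99-background-propagators`, journal page =
PDF page + 388; pp. 397–398, 410, 413, 415–416 re-read on the held text layer by this seat, 2026-08-26).

CITATION HEADER (lean-in-tree rule).  THE PRINTED LOCI (verbatim).  p. 410 [PDF 22], before (3.93): *"each term in this sum
can be estimated by (3.92). The first factor O(1)(Lʲη)² is unessential and is connected with the supremum norm, if we take
another norm we get another factor with a different power of Lʲη. We use part of the exponentials to control the sum over
yᵢ's, let us say the exponentials with ½δ₀ instead of δ₀, the remaining are used to construct an overall exponential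
factor."*; Corollary 3.8, p. 410: *"The term in the expansion (3.90) corresponding to a walk ω = (□₀, □₁, …, □ₙ) depends on U
restricted to □̃⁵₀ ∪ □̃⁵₁ ∪ … ∪ □̃⁵ₙ, and |Δ(y)h_{□₀}G′_{□₀}h_{□₀}Π_{i=1}^n K(h_{□ᵢ})G′_{□ᵢ}h_{□ᵢ}Δ(y′)λ| ≤ O(1)(Lʲη)²O(M^{−1/2})^{|ω|}
M^{−1/2|ω|}e^{−(1/2)δ₀d(ω,y,y′)}|Δ(y′)λ| (3.94) for y ∈ □₀ ∩ Λ_j, y′ ∈ □ₙ.  Similar estimates hold for the other norms."*;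
Theorem 3.10, p. 416 [PDF 28]: *"A term in this expansion, corresponding to a walk ω, depends on configuration U restricted to
X̃⁵₀ ∪ X̃⁵₁ ∪ … ∪ X̃⁵ₙ, satisfies the inequality |(R₀(X₀)R_{α₁}(X₁)·⋯·R_{αₙ}(Xₙ)J)(x)| ≤ O(1)(Lʲη)²O(M^{−1/2})^{|ω|}M^{−1/2|ω|}
e^{−(1/2)δ₀d(ω,y,y′)}|J|, x ∈ Δ(y), y ∈ Λ_j, supp J ⊂ Δ(y′), (3.108) and the corresponding inequalities for norms on the
left-hand sides of (3.42)–(3.47). The constant O(1) depends on d and L only. From (3.108) it follows that the expansion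
(3.107) is convergent in all norms in the inequalities (3.42)–(3.47)."*; the norms themselves are those of Theorem 3.1,
pp. 397–398 [PDF 9–10]: (3.42) (four sup entries, prefactors [(Lʲη)², Lʲη, Lʲη, 1]), (3.43)–(3.45) (Hölder entries,
constants B₀(β), B′₀(ε), B′₀(ε, β)), (3.46) (six L² entries, prefactors [(Lʲη)², Lʲη, Lʲη, 1, 1, 1]), (3.47) (global weighted
norms) with p. 398: *"It is easy to see that the global inequalities (3.47) are consequences of the local ones (3.42) and
Lemma 2.1."*

WHY THIS FILE (cell `lit-balaban`, seat `lit-balaban-type-B9` g0 = R141 (B) Bałaban literature typer «[B9] Thms 3.9–3.15, Cor 3.8 →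
N06»; count-neutral).  `B9.Cor38Printed` and `B9.Thm310Printed` type the SUP ENTRY (3.94)∕(3.108) only: the carrier
`B9.RWExpansion` has ONE real-valued `term U ω λ y` ("the sup quantity |Δ(y)·(ω-term)·Δ(y′)λ|", `B9.lean` docstring), and the
printed sentences *«Similar estimates hold for the other norms»* ∕ *«the corresponding inequalities for norms on the left-hand
sides of (3.42)–(3.47)»* are carried only inside the opaque `Converges` predicate.  Downstream print READS the per-term
all-norms clause explicitly: [Balaban1988RG2Cluster] (1.7) p. 3 *"This bound holds for all operator norms in formulations of
theorems in [13], e.g. in Theorem 3.1"* (typed `B13Sect1Statements.Ineq17` with a norm-dependent prefactor `A y`, supplied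
from [B9] so far only for the sup norm, `eq16_17_of_thm310`).  This file types the clause at `B9.lean`'s carrier level: the
ω-term is seen through a WALK-INDEXED kernel family `termK ω : B9.KernelFamily g B` (the term's own (3.42)–(3.46) quantities),
and the per-term inequalities are the blocks of Theorem 3.1 with the factor e^{−δ₀d(y,y′)} REPLACED by the printed walk
factor `B9.walkFactor C c M δ₀ |ω| d(ω,y,y′)` = O(1)(O(1)M^{−1/2})^{|ω|}M^{−1/2|ω|}e^{−½δ₀d(ω,y,y′)} and the norm's own power of
Lʲη (p. 410: *«another factor with a different power of Lʲη»*).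

WHAT IS DECLARED (definitions with bodies + kernel-checked bookkeeping; NO theorem of the paper is asserted; every `…Printed`
is a `Prop` consumed downstream only as a hypothesis).
* §1 `TermIneq342_346` — per-walk (3.42) (all four sup entries, `B9.pref4`) and (3.46) (all six L² entries, `B9.pref6`);
  `TermIneq343_345` — per-walk Hölder entries (3.43)–(3.45) (constants B₀(β), B′₀(ε), B′₀(ε,β) packed as the walk factor's
  O(1)); projections `sup_of_termIneq` (the `B13Sect1Statements.Ineq17` shape, prefactor `A y = pref4 (Lʲη) n`).
* §2 `Cor38AllNormsPrinted`, `Thm310AllNormsPrinted` — the family statements in the quantifier template of `B9.Cor38Printed` ∕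
  `B9.Thm310Printed` (constants M₂, a₀, δ₀, O(1)'s, B₀(·), B′₀(·), B′₀(·,·) BEFORE the member i and U; hypotheses M ≥ M₂,
  Mα₀ ≤ a₀, (3.35)); bookkeeping `cor38Printed_of_allNorms`, `thm310Printed_of_allNorms`: when the expansion's `term` IS the
  entry n = 0 of `termK`, the all-norms statements contain r1's sup-only statements.
READING NOTES.  (i) (3.47): no per-term global inequality is typed — print derives the global inequalities from the local
ones by Lemma 2.1 [4] (p. 398), for the sum as for each term; (ii) the Hölder supports are those of `B9.Ineq343_345` revision
v4 (ζ ∈ C₀^∞(Δ̃(y)) `cutInT`, supp λ ⊂ Δ̃(y′) `suppInT` in (3.44)–(3.45)); (iii) `first ω y` ∕ `last ω y′` = print's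
«y ∈ □₀ ∩ Λ_j, y′ ∈ □ₙ» (3.94) (for (3.107): the end localizations X₀ ∋ Δ(y), Xₙ ⊃ supp J); (iv) GAPS G-B9-07 (Sect. C proofs
by reference to [3] Prop. 1.2, [4] Prop. 2.2, (2.135) + sketch) travels with these names exactly as with r1's.
HONEST SCOPE: hypothesis-schema typing over EXISTING carriers (`B9.Geometry`, `B9.Backgrounds`, `B9.KernelFamily`,
`B9.RWExpansion`, `B9.walkFactor`); free targets, zero head weight (SKELETON rows B9.Cor3.8 ∕ B9.Thm3.10, owner r06); N06 NOT
discharged; one finite lattice paper; nothing continuum ∕ ℝ⁴ ∕ OS ∕ mass-gap ∕ Clay.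
-/

namespace Literature.MathematicalPhysics.QuantumFieldTheory.Balaban1983to89.B9SectCWalkTermsAllNorms

open B9

variable {g : Geometry} {B : Backgrounds}

/-! ## §1 The per-walk-term blocks: (3.42) + (3.46), and the Hölder entries (3.43)–(3.45) -/

/-- **PER-WALK-TERM (3.42) AND (3.46)** — Corollary 3.8's (3.94) for ALL FOUR sup entries of (3.42) and ALL SIX L² entries of
(3.46) (p. 410: *"The first factor O(1)(Lʲη)² is unessential and is connected with the supremum norm, if we take another norm
we get another factor with a different power of Lʲη … Similar estimates hold for the other norms"*; p. 416 (3.108) *"and the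
corresponding inequalities for norms on the left-hand sides of (3.42)–(3.47)"*): for every walk ω from y (`first`) to y′
(`last`) and every argument supported in Δ(y′), the ω-term — seen through its own (3.42)∕(3.46) quantities `termK ω` — obeys
entry n of (3.42) with the prefactor `pref4 (Lʲη) n` = [(Lʲη)², Lʲη, Lʲη, 1], resp. entry n of (3.46) with `pref6 (Lʲη) n` and
the cut-off's |h|, times the printed walk factor O(1)(O(1)M^{−1/2})^{|ω|}M^{−1/2|ω|}e^{−½δ₀d(ω,y,y′)} (`B9.walkFactor C c M δ₀`).
[cite: Balaban1985BackgroundPropagators, Cor. 3.8 (3.94) p.410, Thm 3.10 (3.108) p.416, (3.42) p.397, (3.46) p.398] -/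
def TermIneq342_346 (E : RWExpansion g B) (termK : E.Walk → KernelFamily g B) (C c δ₀ : ℝ) (U : B.Cfg) : Prop :=
  (∀ (ω : E.Walk) (n : Fin 4) (lam : g.Loc) (y y' : g.Site), E.first ω y → E.last ω y' → g.suppIn lam y' →
      (termK ω).e n U lam y ≤
        pref4 (g.len y) n * walkFactor C c g.M δ₀ (E.wlen ω) (E.wdist ω y y') * g.supNorm lam) ∧
  (∀ (ω : E.Walk) (n : Fin 6) (lam : g.Loc) (h : g.Cut) (y y' : g.Site), E.first ω y → E.last ω y' →
      g.cutIn h y → g.suppIn lam y' →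
      (termK ω).l2 n U lam h ≤
        pref6 (g.len y) n * g.cutSup h * walkFactor C c g.M δ₀ (E.wlen ω) (E.wdist ω y y') * g.l2Norm lam)

/-- **PER-WALK-TERM HÖLDER ENTRIES (3.43)–(3.45)** — the remaining «other norms» of Corollary 3.8 ∕ Theorem 3.10: for every walk
ω from y to y′ the ω-term's Hölder quantities (`termK ω`'s `h1`, `e4`, `h2` = the left-hand sides of (3.43), (3.44), (3.45))
obey the Theorem-3.1 shapes — (Lʲη)^{1−β}(‖ζ‖_β + |ζ|)·|λ| for (3.43) (0 ≤ β < 1, ζ ∈ C₀^∞(Δ̃(y))), (‖λ‖_ε + |λ|) for (3.44)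
(0 < ε ≤ 1, supp λ ⊂ Δ̃(y′)), (Lʲη)^{−β}(‖ζ‖_β + |ζ|)(‖λ‖_{β+ε} + |λ|) for (3.45) — with the β- ∕ ε-dependent constants B₀(β),
B′₀(ε), B′₀(ε, β) (`Bβ`, `Bε`, `Bεβ`, the O(1) of the walk factor) and the walk factor (O(1)M^{−1/2})^{|ω|}M^{−1/2|ω|}
e^{−½δ₀d(ω,y,y′)} in place of e^{−δ₀d(y,y′)}.  Supports as in `B9.Ineq343_345` (revision v4).
[cite: Balaban1985BackgroundPropagators, Cor. 3.8 p.410 («Similar estimates hold for the other norms»), Thm 3.10 p.416, (3.43)–(3.45) p.398] -/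
def TermIneq343_345 (E : RWExpansion g B) (termK : E.Walk → KernelFamily g B) (c δ₀ : ℝ)
    (Bβ Bε : ℝ → ℝ) (Bεβ : ℝ → ℝ → ℝ) (U : B.Cfg) : Prop :=
  (∀ (ω : E.Walk) (β : ℝ) (lam : g.Loc) (ζ : g.Cut) (y y' : g.Site), 0 ≤ β → β < 1 →
      E.first ω y → E.last ω y' → g.cutInT ζ y → g.suppIn lam y' →
      (termK ω).h1 U lam β ζ ≤ (g.len y) ^ (1 - β) * g.cutH β ζ *
        walkFactor (Bβ β) c g.M δ₀ (E.wlen ω) (E.wdist ω y y') * g.supNorm lam) ∧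
  (∀ (ω : E.Walk) (ε : ℝ) (lam : g.Loc) (y y' : g.Site), 0 < ε → ε ≤ 1 →
      E.first ω y → E.last ω y' → g.suppInT lam y' →
      (termK ω).e4 U lam y ≤
        walkFactor (Bε ε) c g.M δ₀ (E.wlen ω) (E.wdist ω y y') * (g.holder ε lam + g.supNorm lam)) ∧
  (∀ (ω : E.Walk) (ε β : ℝ) (lam : g.Loc) (ζ : g.Cut) (y y' : g.Site), 0 < ε → ε ≤ 1 → 0 ≤ β → β < 1 →
      E.first ω y → E.last ω y' → g.cutInT ζ y → g.suppInT lam y' →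
      (termK ω).h2 U lam β ζ ≤ (g.len y) ^ (-β) * g.cutH β ζ *
        walkFactor (Bεβ ε β) c g.M δ₀ (E.wlen ω) (E.wdist ω y y') * (g.holder (β + ε) lam + g.supNorm lam))

/-- The prefactor of the sup norm: entry n = 0 of `pref4` is (Lʲη)² — the «unessential» first factor of (3.92)∕(3.94).
[cite: Balaban1985BackgroundPropagators, (3.92)–(3.94) p.410, (3.42) p.397] -/
theorem pref4_zero (t : ℝ) : pref4 t 0 = t ^ 2 := by
  simp [pref4]

/-- **THE SUP ENTRIES, ONE NORM AT A TIME** — the shape in which [Balaban1988RG2Cluster] (1.7) p. 3 reads the clause (*"This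
bound holds for all operator norms in formulations of theorems in [13], e.g. in Theorem 3.1"*, `B13Sect1Statements.Ineq17`
with the norm's prefactor `A y`): from `TermIneq342_346`, entry n of (3.42) for every walk with `A y = pref4 (Lʲη) n`.
[cite: Balaban1985BackgroundPropagators, Cor. 3.8 (3.94) p.410, Thm 3.10 (3.108) p.416] -/
theorem sup_of_termIneq {E : RWExpansion g B} {termK : E.Walk → KernelFamily g B} {C c δ₀ : ℝ} {U : B.Cfg}
    (h : TermIneq342_346 E termK C c δ₀ U) (n : Fin 4) :
    ∀ (ω : E.Walk) (lam : g.Loc) (y y' : g.Site), E.first ω y → E.last ω y' → g.suppIn lam y' →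
      (termK ω).e n U lam y ≤
        pref4 (g.len y) n * walkFactor C c g.M δ₀ (E.wlen ω) (E.wdist ω y y') * g.supNorm lam :=
  fun ω lam y y' hf hl hs => h.1 ω n lam y y' hf hl hs

/-- The L² entries one at a time (same bookkeeping for (3.46)). [cite: Balaban1985BackgroundPropagators, Cor. 3.8 p.410, (3.46) p.398] -/
theorem l2_of_termIneq {E : RWExpansion g B} {termK : E.Walk → KernelFamily g B} {C c δ₀ : ℝ} {U : B.Cfg}
    (h : TermIneq342_346 E termK C c δ₀ U) (n : Fin 6) :
    ∀ (ω : E.Walk) (lam : g.Loc) (hc : g.Cut) (y y' : g.Site), E.first ω y → E.last ω y' →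
      g.cutIn hc y → g.suppIn lam y' →
      (termK ω).l2 n U lam hc ≤
        pref6 (g.len y) n * g.cutSup hc * walkFactor C c g.M δ₀ (E.wlen ω) (E.wdist ω y y') * g.l2Norm lam :=
  fun ω lam hc y y' hf hl hcut hs => h.2 ω n lam hc y y' hf hl hcut hs

/-! ## §2 The family statements: Corollary 3.8 and Theorem 3.10 with their all-norms clauses -/

/-- **COROLLARY 3.8 WITH ITS LAST SENTENCE** (p. 410 [PDF 22], verbatim in the module docstring: the localisation clause, the
bound (3.94), and *"Similar estimates hold for the other norms"*), in the quantifier template of `B9.Cor38Printed` (constants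
M₂, a₀, δ₀, the two O(1)'s `C`, `c` and the Hölder constants B₀(·), B′₀(·), B′₀(·,·) BEFORE the member i; hypotheses M ≥ M₂,
0 < α₀, Mα₀ ≤ a₀, U in the class (3.35)): every ω-term of the expansion `E i` of G′ (3.90) depends on U restricted to
□̃⁵₀ ∪ … ∪ □̃⁵ₙ (`LocDep`) and obeys the per-term blocks `TermIneq342_346` and `TermIneq343_345` through its quantities
`termK i ω`.  The global norms (3.47) follow from the local ones by Lemma 2.1 [4] (p. 398) and are not typed per term.
GAPS G-B9-07 (proof by reference + sketch). [cite: Balaban1985BackgroundPropagators, Cor. 3.8 (3.93)–(3.94) p.410] -/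
def Cor38AllNormsPrinted {I : Type} (c35 : ℝ) (geo : I → Geometry) (bg : I → Backgrounds)
    (E : ∀ i, RWExpansion (geo i) (bg i)) (termK : ∀ i, (E i).Walk → KernelFamily (geo i) (bg i)) : Prop :=
  ∃ M₂ a₀ δ₀ C c : ℝ, ∃ Bβ Bε : ℝ → ℝ, ∃ Bεβ : ℝ → ℝ → ℝ, 0 < M₂ ∧ 0 < a₀ ∧ 0 < δ₀ ∧ 0 < C ∧ 0 < c ∧
    ∀ i : I, M₂ ≤ (geo i).M → ∀ α₀ : ℝ, 0 < α₀ → (geo i).M * α₀ ≤ a₀ →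
      ∀ U : (bg i).Cfg, (bg i).Reg335 c35 α₀ U →
        (∀ ω : (E i).Walk, (E i).LocDep U ω) ∧
        TermIneq342_346 (E i) (termK i) C c δ₀ U ∧ TermIneq343_345 (E i) (termK i) c δ₀ Bβ Bε Bεβ U

/-- **THEOREM 3.10 WITH ITS ALL-NORMS CLAUSE** (pp. 415–416 [PDF 27–28], verbatim in the module docstring: the expansion (3.107)
of G *"[for] a configuration U satisfying (3.95)"* [sic — (3.35), G-B9-04] is convergent, each ω-term depends on U restricted
to X̃⁵₀ ∪ … ∪ X̃⁵ₙ, satisfies (3.108) *"and the corresponding inequalities for norms on the left-hand sides of (3.42)–(3.47). The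
constant O(1) depends on d and L only"*), in the quantifier template of `B9.Thm310Printed`: `Converges`, `LocDep`, and the
per-term blocks `TermIneq342_346`, `TermIneq343_345` for the walk-indexed family `termK i` (the ω-term applied to bond
functions J).  (3.47) per term: via Lemma 2.1 [4], not typed.  GAPS G-B9-07. [cite: Balaban1985BackgroundPropagators, Thm 3.10 (3.107)–(3.108) pp.415–416] -/
def Thm310AllNormsPrinted {I : Type} (c35 : ℝ) (geo : I → Geometry) (bg : I → Backgrounds)
    (E : ∀ i, RWExpansion (geo i) (bg i)) (termK : ∀ i, (E i).Walk → KernelFamily (geo i) (bg i)) : Prop :=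
  ∃ M₂ a₀ δ₀ C c : ℝ, ∃ Bβ Bε : ℝ → ℝ, ∃ Bεβ : ℝ → ℝ → ℝ, 0 < M₂ ∧ 0 < a₀ ∧ 0 < δ₀ ∧ 0 < C ∧ 0 < c ∧
    ∀ i : I, M₂ ≤ (geo i).M → ∀ α₀ : ℝ, 0 < α₀ → (geo i).M * α₀ ≤ a₀ →
      ∀ U : (bg i).Cfg, (bg i).Reg335 c35 α₀ U →
        (E i).Converges U ∧ (∀ ω : (E i).Walk, (E i).LocDep U ω) ∧
        TermIneq342_346 (E i) (termK i) C c δ₀ U ∧ TermIneq343_345 (E i) (termK i) c δ₀ Bβ Bε Bεβ U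

section Bookkeeping

variable {I : Type} {c35 : ℝ} {geo : I → Geometry} {bg : I → Backgrounds}
  {E : ∀ i, RWExpansion (geo i) (bg i)} {termK : ∀ i, (E i).Walk → KernelFamily (geo i) (bg i)}

/-- **The all-norms Corollary 3.8 contains r1's sup-only `B9.Cor38Printed`** (kernel-checked bookkeeping): when the expansion
carrier's `term` IS the sup entry n = 0 of the walk-indexed family (`hterm` — the reading `B9.lean` gives `RWExpansion.term`),
the first line of `TermIneq342_346` is (3.94) with its (Lʲη)² (`pref4_zero`). [cite: Balaban1985BackgroundPropagators, Cor. 3.8 (3.94) p.410] -/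
theorem cor38Printed_of_allNorms
    (hterm : ∀ (i : I) (U : (bg i).Cfg) (ω : (E i).Walk) (lam : (geo i).Loc) (y : (geo i).Site),
      (E i).term U ω lam y = (termK i ω).e 0 U lam y)
    (h : Cor38AllNormsPrinted c35 geo bg E termK) : Cor38Printed c35 geo bg E := by
  obtain ⟨M₂, a₀, δ₀, C, c, Bβ, Bε, Bεβ, hM, ha, hδ, hC, hc, H⟩ := h
  refine ⟨M₂, a₀, δ₀, C, c, hM, ha, hδ, hC, hc, fun i hMi α₀ hα hMa U hU ω lam y y' hf hl hs => ?_⟩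
  obtain ⟨hloc, h42, -⟩ := H i hMi α₀ hα hMa U hU
  refine ⟨hloc ω, ?_⟩
  have h0 := h42.1 ω 0 lam y y' hf hl hs
  rw [hterm, ← pref4_zero]
  exact h0

/-- **The all-norms Theorem 3.10 contains r1's sup-only `B9.Thm310Printed`** (kernel-checked bookkeeping, same reading
`hterm`). [cite: Balaban1985BackgroundPropagators, Thm 3.10 (3.108) p.416] -/
theorem thm310Printed_of_allNorms
    (hterm : ∀ (i : I) (U : (bg i).Cfg) (ω : (E i).Walk) (lam : (geo i).Loc) (y : (geo i).Site),
      (E i).term U ω lam y = (termK i ω).e 0 U lam y)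
    (h : Thm310AllNormsPrinted c35 geo bg E termK) : Thm310Printed c35 geo bg E := by
  obtain ⟨M₂, a₀, δ₀, C, c, Bβ, Bε, Bεβ, hM, ha, hδ, hC, hc, H⟩ := h
  refine ⟨M₂, a₀, δ₀, C, c, hM, ha, hδ, hC, hc, fun i hMi α₀ hα hMa U hU => ?_⟩
  obtain ⟨hconv, hloc, h42, -⟩ := H i hMi α₀ hα hMa U hU
  refine ⟨hconv, fun ω J y y' hf hl hs => ⟨hloc ω, ?_⟩⟩
  have h0 := h42.1 ω 0 J y y' hf hl hs
  rw [hterm, ← pref4_zero]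
  exact h0

end Bookkeeping

end Literature.MathematicalPhysics.QuantumFieldTheory.Balaban1983to89.B9SectCWalkTermsAllNorms
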